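import Summits.QuantumFields.QCD.Theses.HeatSlicedQuarks
import Summits.QuantumFields.QCD.Theorems.ActionBoundsLowModes.Negative.LoadBearing

/-!
Sketch for crux-ideate `stmt-QuantumFields-8872` (`HeatSlicedQuarks.ActionBoundsLowModes`),
generation 2, round 1, ideator 3 — first lemmas of the idea card `cwikel-spectral-staircase`.
Nothing here is proved except the sanity `example`s; every `def … : Prop` only has to ELABORATE
over existing declarations.

Conventions (tree, `GrassmannIntegral.lean:326`; route item 8875 `AccretiveWilsonDirac`):
`D_W(U,m,1) = m + ½K_U + B`, `K_U ⊗ 1_spin = D_W(U,0,1) + D_W(U,0,1)ᴴ` (covariant Laplacian form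
`Σ_{x,μ} ‖U(x,μ)v(x+μ̂) − v(x)‖²`), `B` anti-Hermitian; `S_W = wilsonAction ρ₃ U = Σ_p (3 − Re tr U_p)`.
The card's operator is `T_U := ½K_U + L⁻²` (the `L⁻²` shift is the crux's `+1`, cf.
`Negative.actionBoundsLowModes_false_without_one`).
-/

open scoped Matrix ComplexConjugate BigOperators ComplexOrder
open Literature.MathematicalPhysics.QuantumFieldTheory
open Literature.MathematicalPhysics.QuantumLattice
open Literature.Probability.LatticeModels

namespace Summit.QuantumFields.QCD.Cruxes.ActionBoundsLowModes.SketchIdeator3g2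

/-- The gauge group of the crux. -/
abbrev SU3 : Type := Matrix.specialUnitaryGroup (Fin 3) ℂ

/-- Its fundamental representation (the `ρ` of `wilsonDirac` / `wilsonAction` in the crux). -/
noncomputable abbrev ρ₃ : SU3 →* Matrix (Fin 3) (Fin 3) ℂ := fundamentalRep (Fin 3)

/-- Quark-field index of the crux: site × colour × spin. -/
abbrev Idx (L : ℕ) : Type := TorusSite 4 L × Fin 3 × Fin 4

/-- Index of the FREE SCALAR comparison walk, realised as the `SU(1)`, one-colour Wilson operator
(so that small tori `L = 1, 2` are treated with exactly the tree's hopping conventions). -/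
abbrev Idx₁ (L : ℕ) : Type := TorusSite 4 L × Fin 1 × Fin 4

/-- `T_U(κ) := ½K_U ⊗ 1_spin + κ` — half the covariant Laplacian form plus the killing shift
(`κ = L⁻²` in the card). `½(D_W(U,0,1) + D_W(U,0,1)ᴴ)` is exactly `½K_U ⊗ 1_spin`
(the `γ_μ` parts cancel, `(1∓γ_μ)/2` sum to `1`). -/
noncomputable def kineticShift {L : ℕ} [NeZero L] (U : GaugeConfig 4 L SU3) (κ : ℝ) :
    Matrix (Idx L) (Idx L) ℂ :=
  (1 / 2 : ℂ) • (wilsonDirac ρ₃ U 0 1 + (wilsonDirac ρ₃ U 0 1)ᴴ) +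
    (κ : ℂ) • (1 : Matrix (Idx L) (Idx L) ℂ)

/-- The free comparison operator `½K_1 ⊗ 1_{Fin 1 × Fin 4} + κ` (four identical copies of the
scalar continuous-time-random-walk generator `½(−Δ)` on the discrete 4-torus, shifted by `κ`). -/
noncomputable def freeKineticShift (L : ℕ) [NeZero L] (κ : ℝ) : Matrix (Idx₁ L) (Idx₁ L) ℂ :=
  (1 / 2 : ℂ) •
      (wilsonDirac (fundamentalRep (Fin 1))
          (fun _ : Edge 4 L => (1 : Matrix.specialUnitaryGroup (Fin 1) ℂ)) 0 1 +
        (wilsonDirac (fundamentalRep (Fin 1))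
          (fun _ : Edge 4 L => (1 : Matrix.specialUnitaryGroup (Fin 1) ℂ)) 0 1)ᴴ) +
    (κ : ℂ) • (1 : Matrix (Idx₁ L) (Idx₁ L) ℂ)

/-! ## Input 1 (U-uniform, "holonomy-blind"): the LOCAL WEYL LAW of `T_U`, resolvent form -/

/-- (W1) WALK DOMINATION OF THE RESOLVENT CUBE DIAGONAL (size S/M, provable now):
`(T_U(κ) + E)⁻³ = Σ_n C(n+2,2) (½Hop_U)ⁿ / (4+κ+E)^{n+3}` is a convergent POSITIVE Neumann series
(`‖½Hop_U‖ ≤ 4 < 4 + κ + E`); the colour–spin trace of its `(x,x)` block is a sum over closed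
lattice walks of `tr(U_walk) · 4` with `|tr U_walk| ≤ 3`, hence is at most `3 ×` the same trace
for the one-colour free operator (which is `4 ×` the scalar walk's return weight). -/
def ResolventCubeDomination : Prop :=
  ∀ (L : ℕ) [NeZero L] (U : GaugeConfig 4 L SU3) (κ E : ℝ), 0 ≤ κ → 0 < E →
    ∀ x : TorusSite 4 L,
      (∑ a : Fin 3, ∑ α : Fin 4,
          (((kineticShift U κ + (E : ℂ) • 1)⁻¹ ^ 3) (x, a, α) (x, a, α)).re) ≤
        3 * ∑ b : Fin 1, ∑ β : Fin 4,
          (((freeKineticShift L κ + (E : ℂ) • 1)⁻¹ ^ 3) (x, b, β) (x, b, β)).re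

/-- (W2) FREE TORUS RESOLVENT-CUBE BOUND (size M, provable now; four cosine sums):
`L⁻⁴ Σ_{p ∈ (2πℤ/L)⁴} (ω(p) + L⁻² + E)⁻³ ≤ C/E` for all `E > 0`, `ω(p) = Σ_μ (1 − cos p_μ) ≥ (2/π²)|p|²`;
the `p = 0` (torus zero-mode) term is `L⁻⁴(L⁻² + E)⁻³ ≤ E⁻¹ · (L⁻⁴ L⁴) = E⁻¹` — this is exactly
where the shift `κ = L⁻²` (the crux's `+1`) is spent. Stated for the trace over the four free
spinor copies. -/
def FreeResolventCubeBound : Prop :=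
  ∃ C : ℝ, ∀ (L : ℕ) [NeZero L] (E : ℝ), 0 < E → ∀ x : TorusSite 4 L,
    (∑ b : Fin 1, ∑ β : Fin 4,
        (((freeKineticShift L (1 / (L : ℝ) ^ 2) + (E : ℂ) • 1)⁻¹ ^ 3) (x, b, β) (x, b, β)).re) ≤ C / E

/-- (W) = (W1) + (W2): the U-UNIFORM LOCAL WEYL LAW of `T_U = ½K_U + L⁻²` in resolvent form,
`tr_{colour,spin} (T_U + E)⁻³(x,x) ≤ C_W / E` for every `E > 0`, every site, every SU(3) field and
every `L`. Since `1(T_U < E) ≤ 8E³ (T_U + E)⁻³`, it gives the spectral-projector diagonal bound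
`tr 1(T_U < E)(x,x) ≤ 8 C_W E²` — the density of states of the covariant Laplacian below `E` is at
most the free one, site by site. This is the ONLY place the gauge field enters the card. -/
def LocalWeylLaw : Prop :=
  ∃ C : ℝ, ∀ (L : ℕ) [NeZero L] (U : GaugeConfig 4 L SU3) (E : ℝ), 0 < E → ∀ x : TorusSite 4 L,
    (∑ a : Fin 3, ∑ α : Fin 4,
        (((kineticShift U (1 / (L : ℝ) ^ 2) + (E : ℂ) • 1)⁻¹ ^ 3) (x, a, α) (x, a, α)).re) ≤ C / E

/-! ## Input 2 (field-free linear algebra): CWIKEL'S STAIRCASE for the Birman–Schwinger operator -/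

/-- (S) THE STAIRCASE LEMMA — Cwikel's 1977 operator-norm/Hilbert–Schmidt interpolation, abstract
and finite-dimensional (size M; spectral theorem NOT needed here, only two orthogonal resolutions
of the identity). Data: a matrix `K`, two families of pairwise orthogonal Hermitian projections
`P k` (k ∈ ℤ, "levels of the potential") and `Q j` (j ∈ ℤ, "dyadic spectral windows of T"), each
summing to `1` over a finite set, with PIECE bounds `‖P_k K Q_j‖ ≤ a·2^{k/2}·2^{j}` (operator norm)
and `‖P_k K Q_j‖_F² ≤ β_k 4^{−j}` (Frobenius). Conclusion: every subspace on which `‖Kw‖ ≥ ‖w‖`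
has dimension `≤ C(a) Σ_k 2^k β_k`. Proof (one page): split the index set along the staircase
`k + 2j ≤ n` / `> n`; on each anti-diagonal `k + 2j = d` the pieces have orthogonal ranges AND
orthogonal co-ranges, so the anti-diagonal has norm `≤ max ≤ a√8·2^{d/2}` and the low part `A`
has `‖A‖ ≤ a√8 Σ_{d≤n} 2^{d/2} ≤ ½` for `n = n(a)`; the high part `B` has
`‖B‖_F² = Σ_{k+2j>n} ‖P_kKQ_j‖_F² ≤ (4/3)2^{−n} Σ_k 2^kβ_k` (cross terms vanish by the same
orthogonality); for an orthonormal basis `(w_i)` of the subspace, `¼ dim ≤ Σ_i ‖Bw_i‖² ≤ ‖B‖_F²`.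
No min–max, no singular values, no integrals. -/
def StaircaseLemma : Prop :=
  ∀ (a : ℝ), 0 < a → ∃ C : ℝ, ∀ (n : Type) [Fintype n] [DecidableEq n] (K : Matrix n n ℂ)
    (P Q : ℤ → Matrix n n ℂ) (KS JS : Finset ℤ) (β : ℤ → ℝ),
    (∀ k, (P k)ᴴ = P k ∧ P k * P k = P k) → (∀ k k', k ≠ k' → P k * P k' = 0) →
    (∑ k ∈ KS, P k = 1) →
    (∀ j, (Q j)ᴴ = Q j ∧ Q j * Q j = Q j) → (∀ j j', j ≠ j' → Q j * Q j' = 0) →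
    (∑ j ∈ JS, Q j = 1) →
    (∀ k, 0 ≤ β k) →
    (∀ (k j : ℤ) (u : n → ℂ),
        ∑ i, ‖(P k * K * Q j).mulVec u i‖ ^ 2 ≤
          a ^ 2 * (2 : ℝ) ^ k * (4 : ℝ) ^ j * ∑ i, ‖u i‖ ^ 2) →
    (∀ (k j : ℤ), ∑ i, ∑ i', ‖(P k * K * Q j) i i'‖ ^ 2 ≤ β k * (4 : ℝ) ^ (-j)) →
    ∀ (S : Submodule ℂ (n → ℂ)),
      (∀ w ∈ S, ∑ i, ‖w i‖ ^ 2 ≤ ∑ i, ‖K.mulVec w i‖ ^ 2) →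
        (Module.finrank ℂ S : ℝ) ≤ C * ∑ k ∈ KS, (2 : ℝ) ^ k * β k

/-- (E) THE ENGINE = Birman–Schwinger + (S), abstract form over `ℓ²(X × F)` (size M given (S)):
for a positive definite `T` whose resolvent cube has a bounded diagonal `Σ_f (T+E)⁻³((x,f),(x,f))
≤ A/E` (local Weyl law, `⇒ tr 1(T<E)(x,x) ≤ 8A E²`) and a site potential `W ≥ 0`, every subspace
on which `⟨u,Tu⟩ ≤ Σ_x W(x)|u(x)|²` has dimension `≤ C·A·Σ_x W(x)²`. Derivation: `S' := T^{1/2}S`,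
`K := W^{1/2}T^{−1/2}` has `‖Kw‖ ≥ ‖w‖` on `S'`; take `P k := 1{2^k ≤ W < 2^{k+1}}` (sites with
`W = 0` carry `W^{1/2} = 0` and are dropped), `Q j := 1_{[4^{−j−1},4^{−j})}(T)`; then
`‖P_kKQ_j‖ ≤ 2^{(k+1)/2}·2^{j+1}` trivially and `‖P_kKQ_j‖_F² = Σ_{x ∈ A_k} W(x) tr(T⁻¹Q_j)(x,x)
≤ 2^{k+1}|A_k|·4^{j+1}·tr 1(T<4^{−j})(x,x) ≤ 2^{k+1}|A_k|·4^{j+1}·8A·4^{−2j}`, i.e.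
`β_k = 64A·2^k|A_k|`, and `Σ_k 2^kβ_k = 64A Σ_k 4^k|A_k| ≤ 64A Σ_x W(x)²`. Same hypothesis and
conclusion shape as the Frank–Rumin engine of the sibling cards (`AbstractCLR4`), different proof
object (singular vectors of the Birman–Schwinger operator instead of the density of a
`T`-orthonormal system); in addition it yields the weak-`𝔖₄` CWIKEL estimate
`#{s_m(K) ≥ τ} ≤ C A τ⁻⁴ Σ W²` (run the same argument at threshold `τ`). -/
def CwikelBirmanSchwinger : Prop :=
  ∃ C : ℝ, ∀ (X F : Type) [Fintype X] [DecidableEq X] [Fintype F] [DecidableEq F]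
    (T : Matrix (X × F) (X × F) ℂ), T.PosDef → ∀ (A : ℝ), 0 ≤ A →
    (∀ (E : ℝ), 0 < E → ∀ x : X, (∑ f : F, (((T + (E : ℂ) • 1)⁻¹ ^ 3) (x, f) (x, f)).re) ≤ A / E) →
    ∀ (W : X → ℝ), (∀ x, 0 ≤ W x) → ∀ (S : Submodule ℂ (X × F → ℂ)),
      (∀ u ∈ S, (∑ i, star (u i) * T.mulVec u i).re ≤ ∑ x, W x * ∑ f, ‖u (x, f)‖ ^ 2) →
        (Module.finrank ℂ S : ℝ) ≤ C * A * ∑ x, (W x) ^ 2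

/-! ## How the card closes the crux (the composition a crux-plan would kernel-check) -/

/-- The local curvature weight of `WilsonLichnerowicz` (8874), copied verbatim from the route file
so that `Σ_x V_F(x)² ≤ C_V · S_W(U)` (Cauchy–Schwarz over the ≤ 7⁴·16 plaquettes within
torusDist 3; a plaquette deficit `3 − Re tr U_p ∈ [0, 9/2]`). -/
noncomputable def curvatureWeight {L : ℕ} [NeZero L] (U : GaugeConfig 4 L SU3)
    (x : TorusSite 4 L) : ℝ :=
  ∑ y ∈ Finset.univ.filter (fun y : TorusSite 4 L => torusDist x y ≤ 3), ∑ μ : Fin 4, ∑ ν : Fin 4,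
    Real.sqrt (3 - ((ρ₃ (plaquetteHolonomy U y μ ν)).trace).re)

/-- (V) `Σ_x V_F(x)² ≤ C_V S_W(U)` (size S, provable now). -/
def CurvatureWeightSq : Prop :=
  ∃ CV : ℝ, ∀ (L : ℕ) [NeZero L] (U : GaugeConfig 4 L SU3),
    ∑ x : TorusSite 4 L, curvatureWeight U x ^ 2 ≤ CV * wilsonAction ρ₃ U

/-- THE LINE. Given `v ∈ E` (‖D_W(U,m,1)v‖² ≤ λ‖v‖²), `WilsonLichnerowicz` (8874) reads
`⟨v, T_U v⟩ = ½K_U[v] + L⁻²‖v‖² ≤ Σ_x W(x)|v(x)|²` with `W := C·V_F + λ + L⁻²` (the real part of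
`⟨v, ½(D(0)+D(0)ᴴ) v⟩` IS `½K_U[v]`, 8875); (E) with `T := T_U`, `A := C_W` from (W) gives
`dim E ≤ C·C_W·Σ_x W² ≤ 3C·C_W (C² C_V S_W + λ²L⁴ + 1)` — the three necessary terms of the crux are
the three summands of `‖W‖₂²` (`Σ_x L⁻⁴ = 1` is the `+1` of `…false_without_one`, `Σ_x λ² = λ²L⁴`
the Weyl term of `…false_without_weyl`). Recorded as the target shape only. -/
def CwikelLine : Prop :=
  LocalWeylLaw → CwikelBirmanSchwinger → CurvatureWeightSq →
    Summit.QuantumFields.QCD.Theses.HeatSlicedQuarks.WilsonLichnerowicz →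
      Summit.QuantumFields.QCD.Theses.HeatSlicedQuarks.ActionBoundsLowModes

/-- TRANSFER target `C⁺` (strictly stronger than what the crux needs, and the reason the staircase
works: weak-`𝔖₄` is stable under dyadic decomposition, bare counting is not): the lattice magnetic
CWIKEL ESTIMATE — for every SU(3) field and every site potential `W ≥ 0`, the Birman–Schwinger
operator `W^{1/2} T_U^{−1/2}` has at most `C τ⁻⁴ Σ_x W(x)²` singular values `≥ τ`, uniformly in
`U, L`. Stated through subspaces (no singular values needed): -/
def LatticeMagneticCwikel : Prop :=
  ∃ C : ℝ, ∀ (L : ℕ) [NeZero L] (U : GaugeConfig 4 L SU3) (W : TorusSite 4 L → ℝ),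
    (∀ x, 0 ≤ W x) → ∀ (τ : ℝ), 0 < τ → ∀ (S : Submodule ℂ (Idx L → ℂ)),
      (∀ u ∈ S, τ ^ 2 * (∑ i, star (u i) * (kineticShift U (1 / (L : ℝ) ^ 2)).mulVec u i).re ≤
          ∑ x, W x * ∑ a : Fin 3, ∑ α : Fin 4, ‖u (x, a, α)‖ ^ 2) →
        (Module.finrank ℂ S : ℝ) ≤ C / τ ^ 4 * ∑ x, (W x) ^ 2

/-! ## Sanity (proved): the imports are the crux's own constants -/

/-- The crux, constant exposed, is the landed Negative module's `ActionBoundsLowModesWith`. -/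
example : Summit.QuantumFields.QCD.Theses.HeatSlicedQuarks.ActionBoundsLowModes ↔
    ∃ C, Summit.QuantumFields.QCD.Theorems.ActionBoundsLowModes.Negative.ActionBoundsLowModesWith C :=
  Summit.QuantumFields.QCD.Theorems.ActionBoundsLowModes.Negative.actionBoundsLowModes_iff

/-- Any constant the line produces must be `≥ 12` (landed tightness lemma) — consistent: the
local Weyl constant `C_W` already carries the factor `12 = 3 colours × 4 spins` of (W1). -/
example {C : ℝ}
    (h : Summit.QuantumFields.QCD.Theorems.ActionBoundsLowModes.Negative.ActionBoundsLowModesWith C) :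
    12 ≤ C :=
  Summit.QuantumFields.QCD.Theorems.ActionBoundsLowModes.Negative.actionBoundsLowModes_twelve_le_const h

/-- `LatticeMagneticCwikel` at `τ = 1` is the counting statement the line needs (pure
specialisation; shows the transfer target is not weaker than its use). -/
theorem counting_of_cwikel (h : LatticeMagneticCwikel) :
    ∃ C : ℝ, ∀ (L : ℕ) [NeZero L] (U : GaugeConfig 4 L SU3) (W : TorusSite 4 L → ℝ),
      (∀ x, 0 ≤ W x) → ∀ (S : Submodule ℂ (Idx L → ℂ)),
        (∀ u ∈ S, (∑ i, star (u i) * (kineticShift U (1 / (L : ℝ) ^ 2)).mulVec u i).re ≤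
            ∑ x, W x * ∑ a : Fin 3, ∑ α : Fin 4, ‖u (x, a, α)‖ ^ 2) →
          (Module.finrank ℂ S : ℝ) ≤ C * ∑ x, (W x) ^ 2 := by
  obtain ⟨C, hC⟩ := h
  refine ⟨C, fun L _ U W hW S hS => ?_⟩
  have h1 := hC L U W hW 1 one_pos S (fun u hu => by simpa using hS u hu)
  simpa using h1

end Summit.QuantumFields.QCD.Cruxes.ActionBoundsLowModes.SketchIdeator3g2
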